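import Mathlib
import HarnessLib
import Summits.HubbardSuperconductivity.HubbardSuperconductivity.Theorems.KLProgrammeKLRegimeEngineGeneralStepResponseFitArith

/-!
# K3 gen-8-FLOW (stmt 20437, stub (C), located «(B)-MAIN-UNPRIMED», cure «(B)-MAIN-PURE»): the arithmetic word of the general-step (B) door under the
# PURE tower law — one more factor `U` in every row of order `l ≥ 1` (cell gate-hubbard-kl, seat p2 g22)

Companion of `…GeneralStepResponseFitArith` (p651628).  With the tower input of the pure-moment door `…MainAliasPosPure.…_pos_pure` obeying the natural law
`Np ≤ cN·U²·(4^m)ˡ` at orders `l ≥ 1` (the bare local vertex drops from the pure moment; the first survivor is the one-loop `O(U²)` correction of range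
`Λ_m⁻¹`), and keeping one of the spare factors `U` of the alias (`U³⁰`) and far (`U⁴`) groups, the door's right-hand side at order `l` is
`≤ X_l·(U·(U²·4^{(l−2)(m+1)}))` with the SAME scale-free `X_l = 2^32/4ˡ·Gfr₀·cN + (Rsq⁴·(cS²+cE+1) + (cSs²+cEs+1))/2^200` as p651628 — i.e. the derivative rows
of the (B) bracket are `|U|`-suppressed and bookable in the (B)-FIT with `μc l := U·X_l` (KL STATUS 2026-08-28, p2 g22 «(B)-MAIN-UNPRIMED» / «(B)-MAIN-PURE»).

* `generalMain_le_pure` (`Np ≤ cN·U²·(4^m)ˡ ⇒ MAIN ≤ (2^32/4ˡ·Gfr₀·cN)·(U·(U²·4^{(l−2)(m+1)}))`, corollary of `generalMain_le` at `cN·U`);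
* `generalAlias_le_U`, `generalFar_le_U` (the alias/far rows with one more `U` kept: `U³⁰ ≤ U³`, `U⁴ ≤ U³`);
* **`generalRHS_le_fit_pure`** — `MAIN + ALIAS + FAR ≤ X_l·(U·(U²·4^{(l−2)(m+1)}))`.

Pure real arithmetic; no definitions; nothing about the model's sizes is asserted; nothing asserts superconductivity.
References: BGM 2006 §2.3 (2.21)–(2.24), §2.4 (2.36) [cite: BenfattoGiulianiMastropietro2006].
-/

noncomputable section

namespace Summit.HubbardSuperconductivity.HubbardSuperconductivity.Theorems.EngineV8

set_option linter.dupNamespace false -- summit = problem name (single-conjunct summit), D-0017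
set_option exponentiation.threshold 1024 -- `2^218`, `2^233`, `2^236` literals

open Real Finset Summit.HubbardSuperconductivity.HubbardSuperconductivity.Theorems.KLRegimeSplit
open Summit.HubbardSuperconductivity.HubbardSuperconductivity.Theorems.KLProgrammeLegKernels
open scoped Nat

/-! ## §1 The MAIN group under the pure law -/

/-- **MAIN under the pure tower law**: `Np ≤ cN·U²·(4^m)ˡ ⇒ MAIN ≤ (2^32/4ˡ·Gfr₀·cN)·(U·(U²·4^{(l−2)(m+1)}))` (`generalMain_le` at the constant `cN·U`).
[cite: BenfattoGiulianiMastropietro2006, §2.3 (2.21), §2.4 (2.36)] -/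
theorem generalMain_le_pure {β fd Np Gfr0 cN U : ℝ} {L m l : ℕ} (hβ : 0 < β) (hπ : Real.pi / β ≤ klScale klE0 m / 4)
    (hL : 32 * (4 : ℝ) ^ m ≤ (L : ℝ)) (hfd0 : 0 ≤ fd) (hfd : fd ≤ Gfr0 * U * (((4 : ℝ) ^ m) ^ 2)⁻¹) (hNp0 : 0 ≤ Np)
    (hNp : Np ≤ cN * U ^ 2 * ((4 : ℝ) ^ m) ^ l) (hG : 0 ≤ Gfr0) (hU : 0 ≤ U) (hcN : 0 ≤ cN) :
    2 * (2 * (|β| * (L : ℝ) ^ 2) * (12 * (2 * ((klScale klE0 m) * β / Real.pi + 3) * ((1793 * (klScale klE0 m) * (L : ℝ) ^ 2 + 704 * L) +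
      (1793 * (klScale klE0 m) * (L : ℝ) ^ 2 + 704 * L)) * (β * (L : ℝ) ^ 2 * (200 + 200 * 4) / (klScale klE0 m) ^ 2 * fd)) * (Np / (β * (L : ℝ) ^ 2) ^ 3))) ≤
      2 ^ 32 / 4 ^ l * Gfr0 * cN * (U * (U ^ 2 * (4 : ℝ) ^ (((l : ℤ) - 2) * ((m + 1 : ℕ) : ℤ)))) := by
  have hNp' : Np ≤ cN * U * U * ((4 : ℝ) ^ m) ^ l := hNp.trans (le_of_eq (by ring))
  have h := generalMain_le (l := l) hβ hπ hL hfd0 hfd hNp0 hNp' hG hU (mul_nonneg hcN hU)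
  exact h.trans (le_of_eq (by ring))

/-! ## §2 The ALIAS and FAR groups with one more `U` -/

/-- **ALIAS with one more `U`**: as `generalAlias_le` but `≤ (Rsq⁴·(cS²+cE+1)/2^200)·(U·(U²·4^{(l−2)(m+1)}))` (`U³⁰ ≤ U³`).
[cite: BenfattoGiulianiMastropietro2006, §2.3 (2.24)] -/
theorem generalAlias_le_U (R : RenConsts) {β U Nj Nj' cS cE : ℝ} {m l : ℕ} (hβ : klBetaMin ≤ β) (hm : m ≤ nScales β + 1)
    (hU : 0 ≤ U) (hU1 : U ≤ 1) (hl : l ≤ 4) (hNj0 : 0 ≤ Nj) (hNj : Nj ≤ cS * U * ((4 : ℝ) ^ m) ^ l)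
    (hNj' : Nj' ≤ 2 * (cE * U * ((4 : ℝ) ^ m) ^ l)) (hcS : 0 ≤ cS) (hcE : 0 ≤ cE) :
    (2 ^ 29 * (4 : ℝ) ^ m * Nj ^ 2 + 2 ^ 12 + 2 ^ 23 * Nj') * (Real.sqrt (klEngRsq R) ^ 8 * U ^ 30 / (2 ^ 218 * β ^ 14)) ≤
      klEngRsq R ^ 4 * (cS ^ 2 + cE + 1) / 2 ^ 200 * (U * (U ^ 2 * (4 : ℝ) ^ (((l : ℤ) - 2) * ((m + 1 : ℕ) : ℤ)))) := by
  have hβ0 : 0 < β := pos_of_klBetaMin_le hβ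
  set P : ℝ := (4 : ℝ) ^ m with hPdef
  have hP1 : 1 ≤ P := one_le_pow₀ (by norm_num)
  have hP0 : 0 < P := by positivity
  have hRsq := klEngRsq_pos R
  rw [sqrt_klEngRsq_pow_eight, readExp_zpow_eq]
  -- the bracket `≤ 2^29·(cS²+cE+1)·P^11`
  have hPl : P ^ l ≤ P ^ 11 := pow_le_pow_right₀ hP1 (by omega)
  have hP2l : P * (P ^ l) ^ 2 ≤ P ^ 11 := by
    rw [← pow_mul, ← pow_succ']
    exact pow_le_pow_right₀ hP1 (by omega)
  have hNjU : Nj ≤ cS * P ^ l := by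
    calc Nj ≤ cS * U * P ^ l := hNj
      _ ≤ cS * 1 * P ^ l := by gcongr
      _ = cS * P ^ l := by ring
  have hNj2 : Nj ^ 2 ≤ cS ^ 2 * (P ^ l) ^ 2 := by
    rw [← mul_pow]; exact pow_le_pow_left₀ hNj0 hNjU 2
  have hNj'U : Nj' ≤ 2 * cE * P ^ l := by
    calc Nj' ≤ 2 * (cE * U * P ^ l) := hNj'
      _ ≤ 2 * (cE * 1 * P ^ l) := by gcongr
      _ = 2 * cE * P ^ l := by ring
  have hbr : 2 ^ 29 * P * Nj ^ 2 + 2 ^ 12 + 2 ^ 23 * Nj' ≤ 2 ^ 29 * (cS ^ 2 + cE + 1) * P ^ 11 := by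
    have e1 : 2 ^ 29 * P * Nj ^ 2 ≤ 2 ^ 29 * cS ^ 2 * P ^ 11 := by
      calc 2 ^ 29 * P * Nj ^ 2 ≤ 2 ^ 29 * P * (cS ^ 2 * (P ^ l) ^ 2) := by gcongr
        _ = 2 ^ 29 * cS ^ 2 * (P * (P ^ l) ^ 2) := by ring
        _ ≤ 2 ^ 29 * cS ^ 2 * P ^ 11 := by gcongr
    have e2 : (2 : ℝ) ^ 12 ≤ 2 ^ 29 * P ^ 11 := by
      have : (1 : ℝ) ≤ P ^ 11 := one_le_pow₀ hP1
      nlinarith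
    have e3 : 2 ^ 23 * Nj' ≤ 2 ^ 29 * cE * P ^ 11 := by
      calc 2 ^ 23 * Nj' ≤ 2 ^ 23 * (2 * cE * P ^ l) := by gcongr
        _ = 2 ^ 24 * cE * P ^ l := by ring
        _ ≤ 2 ^ 24 * cE * P ^ 11 := by gcongr
        _ ≤ 2 ^ 29 * cE * P ^ 11 := by gcongr <;> norm_num
    nlinarith
  -- `U^30 ≤ U³`
  have hU30 : U ^ 30 ≤ U ^ 3 := pow_le_pow_of_le_one hU hU1 (by norm_num)
  have hlad := alias_ladder_le hβ hm
  -- the ladder: `2^29·P^11/(2^218β^14) ≤ 1/(2^204·P²)`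
  have hkey : 2 ^ 29 * P ^ 11 / (2 ^ 218 * β ^ 14) ≤ 1 / (2 ^ 200 * (16 * P ^ 2)) := by
    rw [div_le_div_iff₀ (by positivity) (by positivity)]
    have e : 2 ^ 29 * P ^ 11 * (2 ^ 200 * (16 * P ^ 2)) = 2 ^ 233 * P ^ 13 := by ring
    rw [e, one_mul]
    exact hlad
  have hC0 : 0 ≤ klEngRsq R ^ 4 * (cS ^ 2 + cE + 1) := by positivity
  calc (2 ^ 29 * P * Nj ^ 2 + 2 ^ 12 + 2 ^ 23 * Nj') * (klEngRsq R ^ 4 * U ^ 30 / (2 ^ 218 * β ^ 14))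
      ≤ (2 ^ 29 * (cS ^ 2 + cE + 1) * P ^ 11) * (klEngRsq R ^ 4 * U ^ 3 / (2 ^ 218 * β ^ 14)) := by
        apply mul_le_mul hbr _ (by positivity) (by positivity)
        gcongr
    _ = klEngRsq R ^ 4 * (cS ^ 2 + cE + 1) * U ^ 3 * (2 ^ 29 * P ^ 11 / (2 ^ 218 * β ^ 14)) := by ring
    _ ≤ klEngRsq R ^ 4 * (cS ^ 2 + cE + 1) * U ^ 3 * (1 / (2 ^ 200 * (16 * P ^ 2))) :=
        mul_le_mul_of_nonneg_left hkey (by positivity)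
    _ = klEngRsq R ^ 4 * (cS ^ 2 + cE + 1) / 2 ^ 200 * (U * (U ^ 2 * (1 / (16 * P ^ 2)))) := by ring
    _ ≤ klEngRsq R ^ 4 * (cS ^ 2 + cE + 1) / 2 ^ 200 * (U * (U ^ 2 * ((4 : ℝ) ^ l * P ^ l / (16 * P ^ 2)))) := by
        apply mul_le_mul_of_nonneg_left _ (by positivity)
        apply mul_le_mul_of_nonneg_left _ hU
        apply mul_le_mul_of_nonneg_left _ (by positivity)
        apply div_le_div_of_nonneg_right _ (by positivity)
        exact one_le_mul_of_one_le_of_one_le (one_le_pow₀ (by norm_num)) (one_le_pow₀ hP1)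

/-- **FAR with one more `U`**: as `generalFar_le` but `≤ ((cSs²+cEs+1)/2^200)·(U·(U²·4^{(l−2)(m+1)}))` (`U⁴ ≤ U³`).
[cite: BenfattoGiulianiMastropietro2006, §2.3 (2.24)] -/
theorem generalFar_le_U (P : SplitConsts) (R : RenConsts) {β U Ns Ns' cSs cEs : ℝ} {m l : ℕ} (hβ : klBetaMin ≤ β) (hm : m ≤ nScales β + 1)
    (hU : 0 ≤ U) (hU1 : U ≤ 1) (hNs0 : 0 ≤ Ns) (hNs : Ns ≤ cSs * U) (hNs' : Ns' ≤ 2 * (cEs * U)) (hcSs : 0 ≤ cSs) (hcEs : 0 ≤ cEs) :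
    (2 ^ 26 * (4 : ℝ) ^ m * Ns ^ 2 + 2 ^ 9 + 2 ^ 20 * Ns') * (U / (2 ^ 59 * klEngPsq P ^ 2 * klEngRsq R ^ 2 * β ^ 3)) ^ 4 ≤
      (cSs ^ 2 + cEs + 1) / 2 ^ 200 * (U * (U ^ 2 * (4 : ℝ) ^ (((l : ℤ) - 2) * ((m + 1 : ℕ) : ℤ)))) := by
  have hβ0 : 0 < β := pos_of_klBetaMin_le hβ
  have h128 : (128 : ℝ) ≤ β := by simpa [klBetaMin] using hβ
  set Pm : ℝ := (4 : ℝ) ^ m with hPdef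
  have hP1 : 1 ≤ Pm := one_le_pow₀ (by norm_num)
  have hP0 : 0 < Pm := by positivity
  have hP8 : Pm ≤ β / 8 := four_pow_le_beta_div_eight hβ hm
  rw [readExp_zpow_eq]
  -- `Xv⁴ ≤ U²/(2^236·β^12)`
  have hXv := xv_le_inv_cube P R hU1 hβ0
  have hXv0 : 0 ≤ U / (2 ^ 59 * klEngPsq P ^ 2 * klEngRsq R ^ 2 * β ^ 3) :=
    div_nonneg hU (by have := klEngPsq_pos P; have := klEngRsq_pos R; positivity)
  have hXvU : U / (2 ^ 59 * klEngPsq P ^ 2 * klEngRsq R ^ 2 * β ^ 3) ≤ U / (2 ^ 59 * β ^ 3) := by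
    apply div_le_div_of_nonneg_left hU (by positivity)
    have hPR : 1 ≤ klEngPsq P ^ 2 * klEngRsq R ^ 2 :=
      one_le_mul_of_one_le_of_one_le (one_le_pow₀ (one_le_klEngPsq P)) (one_le_pow₀ (one_le_klEngRsq R))
    nlinarith [pow_pos hβ0 3]
  have hX4 : (U / (2 ^ 59 * klEngPsq P ^ 2 * klEngRsq R ^ 2 * β ^ 3)) ^ 4 ≤ U ^ 3 / (2 ^ 236 * β ^ 12) := by
    calc (U / (2 ^ 59 * klEngPsq P ^ 2 * klEngRsq R ^ 2 * β ^ 3)) ^ 4 ≤ (U / (2 ^ 59 * β ^ 3)) ^ 4 := pow_le_pow_left₀ hXv0 hXvU 4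
      _ = U ^ 4 / (2 ^ 236 * β ^ 12) := by rw [div_pow]; ring
      _ ≤ U ^ 3 / (2 ^ 236 * β ^ 12) := by
          apply div_le_div_of_nonneg_right _ (by positivity)
          exact pow_le_pow_of_le_one hU hU1 (by norm_num)
  -- the bracket `≤ 2^26·(cSs²+cEs+1)·Pm`
  have hNsU : Ns ≤ cSs := by nlinarith
  have hNs2 : Ns ^ 2 ≤ cSs ^ 2 := pow_le_pow_left₀ hNs0 hNsU 2
  have hNs'U : Ns' ≤ 2 * cEs := by nlinarith
  have hbr : 2 ^ 26 * Pm * Ns ^ 2 + 2 ^ 9 + 2 ^ 20 * Ns' ≤ 2 ^ 26 * (cSs ^ 2 + cEs + 1) * Pm := by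
    have e1 : 2 ^ 26 * Pm * Ns ^ 2 ≤ 2 ^ 26 * Pm * cSs ^ 2 := by gcongr
    have e3 : 2 ^ 20 * Ns' ≤ 2 ^ 26 * cEs * Pm := by nlinarith
    nlinarith
  -- the ladder: `2^26·Pm/(2^236β^12) ≤ 1/(2^204·Pm²)` iff `2^230·Pm³ ≤ 2^236·β^12`
  have hlad : 2 ^ 26 * Pm * (2 ^ 200 * (16 * Pm ^ 2)) ≤ 1 * (2 ^ 236 * β ^ 12) := by
    have h3 : Pm ^ 3 ≤ (β / 8) ^ 3 := pow_le_pow_left₀ hP0.le hP8 3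
    have hβ3 : 0 ≤ β ^ 3 := by positivity
    have hβ9 : (1 : ℝ) ≤ β ^ 9 := one_le_pow₀ (by linarith)
    have e : (β / 8) ^ 3 = β ^ 3 / 512 := by rw [div_pow]; norm_num
    rw [e] at h3
    have : Pm ^ 3 ≤ β ^ 12 := by
      calc Pm ^ 3 ≤ β ^ 3 / 512 := h3
        _ ≤ β ^ 3 := by linarith
        _ ≤ β ^ 3 * β ^ 9 := le_mul_of_one_le_right hβ3 hβ9
        _ = β ^ 12 := by ring
    nlinarith
  have hkey : 2 ^ 26 * Pm / (2 ^ 236 * β ^ 12) ≤ 1 / (2 ^ 200 * (16 * Pm ^ 2)) := by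
    rw [div_le_div_iff₀ (by positivity) (by positivity)]
    exact hlad
  have hC0 : 0 ≤ cSs ^ 2 + cEs + 1 := by positivity
  calc (2 ^ 26 * Pm * Ns ^ 2 + 2 ^ 9 + 2 ^ 20 * Ns') * (U / (2 ^ 59 * klEngPsq P ^ 2 * klEngRsq R ^ 2 * β ^ 3)) ^ 4
      ≤ (2 ^ 26 * (cSs ^ 2 + cEs + 1) * Pm) * (U ^ 3 / (2 ^ 236 * β ^ 12)) :=
        mul_le_mul hbr hX4 (pow_nonneg hXv0 4) (by positivity)
    _ = (cSs ^ 2 + cEs + 1) * U ^ 3 * (2 ^ 26 * Pm / (2 ^ 236 * β ^ 12)) := by ring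
    _ ≤ (cSs ^ 2 + cEs + 1) * U ^ 3 * (1 / (2 ^ 200 * (16 * Pm ^ 2))) := mul_le_mul_of_nonneg_left hkey (by positivity)
    _ = (cSs ^ 2 + cEs + 1) / 2 ^ 200 * (U * (U ^ 2 * (1 / (16 * Pm ^ 2)))) := by ring
    _ ≤ (cSs ^ 2 + cEs + 1) / 2 ^ 200 * (U * (U ^ 2 * ((4 : ℝ) ^ l * Pm ^ l / (16 * Pm ^ 2)))) := by
        apply mul_le_mul_of_nonneg_left _ (by positivity)
        apply mul_le_mul_of_nonneg_left _ hU
        apply mul_le_mul_of_nonneg_left _ (by positivity)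
        apply div_le_div_of_nonneg_right _ (by positivity)
        exact one_le_mul_of_one_le_of_one_le (one_le_pow₀ (by norm_num)) (one_le_pow₀ hP1)

/-! ## §3 The door's right-hand side under the pure law -/

/-- **THE GENERAL-STEP (B) DOOR'S RIGHT-HAND SIDE UNDER THE PURE TOWER LAW**: for `m + 1 ≤ n_β`, `klEngL₄ ≤ L`, `l ≤ 4`, `Np ≤ cN·U²·(4^m)ˡ` and the other laws
of p651628, `MAIN + ALIAS + FAR ≤ (2^32/4ˡ·Gfr₀·cN + (Rsq⁴·(cS²+cE+1) + (cSs²+cEs+1))/2^200)·(U·(U²·4^{(l−2)(m+1)}))`.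
[cite: BenfattoGiulianiMastropietro2006, §2.3 (2.21)–(2.24), §2.4 (2.36)] -/
theorem generalRHS_le_fit_pure (P : SplitConsts) (R : RenConsts) {β U fd Np Nj Nj' Ns Ns' cN cS cE cSs cEs : ℝ} {L m l : ℕ}
    (hβ : klBetaMin ≤ β) (hm : m + 1 ≤ nScales β) (hU : 0 < U) (hU1 : U ≤ 1) (hL : klEngL₄ P R β U ≤ L) (hl : l ≤ 4)
    (hfd0 : 0 ≤ fd) (hfd : fd ≤ R.Gfr 0 * U * (((4 : ℝ) ^ m) ^ 2)⁻¹) (hG : 0 ≤ R.Gfr 0)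
    (hNp0 : 0 ≤ Np) (hNp : Np ≤ cN * U ^ 2 * ((4 : ℝ) ^ m) ^ l)
    (hNj0 : 0 ≤ Nj) (hNj : Nj ≤ cS * U * ((4 : ℝ) ^ m) ^ l) (hNj' : Nj' ≤ 2 * (cE * U * ((4 : ℝ) ^ m) ^ l))
    (hNs0 : 0 ≤ Ns) (hNs : Ns ≤ cSs * U) (hNs' : Ns' ≤ 2 * (cEs * U))
    (hcN : 0 ≤ cN) (hcS : 0 ≤ cS) (hcE : 0 ≤ cE) (hcSs : 0 ≤ cSs) (hcEs : 0 ≤ cEs) :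
    2 * (2 * (|β| * (L : ℝ) ^ 2) * (12 * (2 * ((klScale klE0 m) * β / Real.pi + 3) * ((1793 * (klScale klE0 m) * (L : ℝ) ^ 2 + 704 * L) +
      (1793 * (klScale klE0 m) * (L : ℝ) ^ 2 + 704 * L)) * (β * (L : ℝ) ^ 2 * (200 + 200 * 4) / (klScale klE0 m) ^ 2 * fd)) * (Np / (β * (L : ℝ) ^ 2) ^ 3))) +
      ((2 ^ 29 * (4 : ℝ) ^ m * Nj ^ 2 + 2 ^ 12 + 2 ^ 23 * Nj') * (Real.sqrt (klEngRsq R) ^ 8 * U ^ 30 / (2 ^ 218 * β ^ 14)) +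
        (2 ^ 26 * (4 : ℝ) ^ m * Ns ^ 2 + 2 ^ 9 + 2 ^ 20 * Ns') * (U / (2 ^ 59 * klEngPsq P ^ 2 * klEngRsq R ^ 2 * β ^ 3)) ^ 4) ≤
      (2 ^ 32 / 4 ^ l * R.Gfr 0 * cN + (klEngRsq R ^ 4 * (cS ^ 2 + cE + 1) + (cSs ^ 2 + cEs + 1)) / 2 ^ 200) *
        (U * (U ^ 2 * (4 : ℝ) ^ (((l : ℤ) - 2) * ((m + 1 : ℕ) : ℤ)))) := by
  have hβ0 : 0 < β := pos_of_klBetaMin_le hβ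
  have hmβ : m ≤ nScales β + 1 := by omega
  have h1 := generalMain_le_pure (l := l) hβ0 (pi_div_le_klScale_div_four_of_succ_le_nScales hβ hm) (thirtytwo_mul_four_pow_le hβ hU hU1 hm hL)
    hfd0 hfd hNp0 hNp hG hU.le hcN
  have h2 := generalAlias_le_U R (l := l) hβ hmβ hU.le hU1 hl hNj0 hNj hNj' hcS hcE
  have h3 := generalFar_le_U P R (l := l) hβ hmβ hU.le hU1 hNs0 hNs hNs' hcSs hcEs
  calc _ ≤ 2 ^ 32 / 4 ^ l * R.Gfr 0 * cN * (U * (U ^ 2 * (4 : ℝ) ^ (((l : ℤ) - 2) * ((m + 1 : ℕ) : ℤ)))) +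
        (klEngRsq R ^ 4 * (cS ^ 2 + cE + 1) / 2 ^ 200 * (U * (U ^ 2 * (4 : ℝ) ^ (((l : ℤ) - 2) * ((m + 1 : ℕ) : ℤ)))) +
          (cSs ^ 2 + cEs + 1) / 2 ^ 200 * (U * (U ^ 2 * (4 : ℝ) ^ (((l : ℤ) - 2) * ((m + 1 : ℕ) : ℤ))))) := add_le_add h1 (add_le_add h2 h3)
    _ = _ := by ring

end Summit.HubbardSuperconductivity.HubbardSuperconductivity.Theorems.EngineV8

end
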